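import Literature.NumberTheory.EllipticCurves.PadicSigmaUniquenessProofs
import HarnessLib

/-!
# From the squared functional equation to DWORK'S SHAPE `H″(T) = H²·V` (`H = (σ/z)²`) — step S6 glue of the discharge plan for the
# PRINT stub `stub_sigmaSqTwo`

Cell `bsd-f1-sign2`, WIDTH-5 attach seat `bsd-line-att-p3` g8 (`--supports stmt-BirchSwinnertonDyer-23008`; plan
`Cruxes/BSDOfMainConjectureRankOneAtTwo/SIGMASQ-AT-TWO-att-p3.md`, §7/S6). THEOREMS ONLY; route-independent; pure power-series algebra over a domain.
BSD is not proved by any of this.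

The squared `2`-isogeny functional equation (`velu_two_X_sq_mul_sq_subst_eq_domain`, `…SigmaSqTwoDomainFE.lean`) reads, for the Frobenius model
(`u = 2`): `z²·σ″(T)² = 4·σ⁴·A`, `A = X − e z²`, with `T = 2z + ⋯` (`[z¹]T = u = 2`). Writing `σ = z·s`, `σ″ = z·s″`, `T = 2z·Tₙ` (`Tₙ = 1 + ⋯`,
available once `2` is invertible, e.g. over `K₂ = R̂₂[1/2]`), `H = s²`, `H″ = s″²`, it becomes **`H″(T) = H²·V` with `V = A·Tₙ⁻²`** — literally the
hypothesis `heq : (s.map α).subst φ = s ^ p * u` of the tree's Dwork lemma `Literature.RingTheory.FormalGroups.coeff_mem_of_map_subst_eq_pow_mul`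
(`p = 2`, `s = H`, `φ = T`, `u = V`) as soon as `σ″ = σ^α` (`sigmaShift_map`: then `H″ = H^α`). The remaining Dwork hypotheses — `T ≡ z²`,
`V ≡ 1 (mod 2)` coefficientwise with coefficients in `R̂₂`, `[z¹]H ∈ R̂₂` (`coeff_one_sigmaShift_sq`: `[z¹]H = 2[z²]σ = a₁ = 1` for an odd `σ`) —
are the Frobenius-model congruences of plan step S3.

* `sigmaShift_map` — `s(σ^φ) = s(σ)^φ`;  `coeff_one_sigmaShift_sq` — `[z¹](s²) = 2[z²]σ` for `σ = z + ⋯`;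
* `subst_eq_mul_sigmaShift_subst` — `σ″(T) = T·s″(T)`;
* `dworkShape_of_sq_functionalEquation` — **`z²σ″(T)² = 4σ⁴A`, `T = 2z·Tₙ` ⟹ `(s″²)(T) = (s²)²·(A·Tₙ⁻²)`.**

## Sources
B. Dwork's lemma in Hazewinkel's functional-equation form as used by C. Blakestad, D. Grant, J. Number Theory 249 (2023), Lemma 5, Cor. 6, Prop. 13
[cite: BlakestadGrant2023, Prop. 13]; N. Koblitz, GTM 58, Ch. IV §2 Lemma 3 [cite: Koblitz1984, Ch. IV §2 Lemma 3].
-/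

noncomputable section

set_option linter.dupNamespace false
set_option autoImplicit false

open scoped Classical
open PowerSeries Literature.NumberTheory.EllipticCurves

namespace Summit.BirchSwinnertonDyer.BirchSwinnertonDyer.Theorems.AlignedTransportAtTwoSigmaSqTwo

section Shape

variable {K : Type*} [CommRing K]

/-- `s(σ^φ) = s(σ)^φ`: the shift `σ ↦ σ/z` commutes with base change. [folklore] -/
theorem sigmaShift_map {S : Type*} [CommRing S] (φ : K →+* S) (σ : K⟦X⟧) :
    sigmaShift (PowerSeries.map φ σ) = PowerSeries.map φ (sigmaShift σ) := by
  ext n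
  rw [coeff_sigmaShift, coeff_map, coeff_map, coeff_sigmaShift]

/-- `[z¹](s²) = 2·[z²]σ` for `σ = z + ⋯` (`s = σ/z = 1 + [z²]σ·z + ⋯`); for a Mazur–Tate-odd `σ` this is `a₁`
(`two_mul_coeff_two_of_isFormallyOdd`), `= 1` on the `a₁`-chart. [folklore] -/
theorem coeff_one_sigmaShift_sq {σ : K⟦X⟧} (h1 : coeff 1 σ = 1) : coeff 1 (sigmaShift σ ^ 2) = 2 * coeff 2 σ := by
  rw [pow_two, coeff_one_mul_eq, coeff_zero_eq_constantCoeff_apply, constantCoeff_sigmaShift, h1, coeff_sigmaShift]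
  ring

/-- `σ″(T) = T·s″(T)` for `σ″ = z·s″`, `T(0) = 0`. [folklore] -/
theorem subst_eq_mul_sigmaShift_subst {σ'' T : K⟦X⟧} (hσ0 : constantCoeff σ'' = 0) (hT0 : constantCoeff T = 0) :
    σ''.subst T = T * (sigmaShift σ'').subst T := by
  have hs : HasSubst T := HasSubst.of_constantCoeff_zero' hT0
  conv_lhs => rw [← X_mul_sigmaShift hσ0]
  rw [subst_mul hs, subst_X hs]

variable [IsDomain K]

/-- **Dwork's shape from the squared functional equation.** Over a domain in which `2 ≠ 0`: if `σ(0) = σ″(0) = T(0) = 0`,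
`σ/z =: s`, `σ″/z =: s″`, `T/z = 2·Tₙ` and `z²·σ″(T)² = 4·σ⁴·A`, then `(s″²)(T) = (s²)²·(A·Tₙ⁻²)` — i.e. `H″(T) = H²·V` with `H = s²`,
`H″ = s″²`, `V = A·Tₙ⁻²` (`Tₙ(0) = 1` is forced by `[z¹]T = 2`). [cite: BlakestadGrant2023, Prop. 13] -/
theorem dworkShape_of_sq_functionalEquation (h2 : (2 : K) ≠ 0) {σ σ'' T A Tn : K⟦X⟧}
    (hσ0 : constantCoeff σ = 0) (hσ0'' : constantCoeff σ'' = 0) (hT0 : constantCoeff T = 0) (hT1 : coeff 1 T = 2)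
    (hTn : sigmaShift T = C (2 : K) * Tn)
    (hFE : X ^ 2 * σ''.subst T ^ 2 = C (2 : K) ^ 2 * σ ^ 4 * A) :
    (sigmaShift σ'' ^ 2).subst T = (sigmaShift σ ^ 2) ^ 2 * (A * invOfUnit (Tn ^ 2) 1) := by
  have hs : HasSubst T := HasSubst.of_constantCoeff_zero' hT0
  -- `Tn(0) = 1`
  have hTn0 : constantCoeff Tn = 1 := by
    have e := congrArg constantCoeff hTn
    rw [constantCoeff_sigmaShift, hT1, map_mul, constantCoeff_C] at e
    have e' : (2 : K) * (constantCoeff Tn - 1) = 0 := by linear_combination -e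
    have := (mul_eq_zero.mp e').resolve_left h2
    linear_combination this
  have hinv : Tn ^ 2 * invOfUnit (Tn ^ 2) 1 = 1 := mul_invOfUnit (Tn ^ 2) 1 (by rw [map_pow, hTn0, one_pow, Units.val_one])
  -- `T = 2 z Tn`, `σ = z s`, `σ″(T) = T s″(T)`
  have hT : T = C (2 : K) * X * Tn := by
    rw [← X_mul_sigmaShift hT0, hTn]; ring
  have hσ : σ = X * sigmaShift σ := (X_mul_sigmaShift hσ0).symm
  have hσT := subst_eq_mul_sigmaShift_subst hσ0'' hT0
  set sT := (sigmaShift σ'').subst T with hsT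
  set s := sigmaShift σ with hsdef
  -- the functional equation, divided by `4z⁴`
  have hFE' : (C (4 : K) * X ^ 4) * (Tn ^ 2 * sT ^ 2) = (C (4 : K) * X ^ 4) * (s ^ 4 * A) := by
    have e := hFE
    rw [hσT, hT, hσ] at e
    have h4 : (C (4 : K) : K⟦X⟧) = C 2 * C 2 := by rw [← map_mul]; norm_num
    rw [h4]
    linear_combination e
  have hne : (C (4 : K) : K⟦X⟧) * X ^ 4 ≠ 0 := by
    refine mul_ne_zero ?_ (pow_ne_zero 4 X_ne_zero)
    have h4 : (4 : K) ≠ 0 := by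
      have : (4 : K) = 2 * 2 := by norm_num
      rw [this]; exact mul_ne_zero h2 h2
    intro h
    apply h4
    have := congrArg constantCoeff h
    rwa [constantCoeff_C, map_zero] at this
  have hkey : Tn ^ 2 * sT ^ 2 = s ^ 4 * A := mul_left_cancel₀ hne hFE'
  rw [subst_pow hs]
  calc sT ^ 2 = sT ^ 2 * (Tn ^ 2 * invOfUnit (Tn ^ 2) 1) := by rw [hinv, mul_one]
    _ = (Tn ^ 2 * sT ^ 2) * invOfUnit (Tn ^ 2) 1 := by ring
    _ = (s ^ 2) ^ 2 * (A * invOfUnit (Tn ^ 2) 1) := by rw [hkey]; ring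

/-- **Dwork's shape for the Frobenius model with `u = 2μ`, `μ` a unit** (plan §8 (S3.3)/(S3.5)): if `z²·σ″(T)² = (2μ)²·σ⁴·A`,
`T/z = 2·Tₙ` with `Tₙ(0) = μ`, then `(s″²)(T) = (s²)²·(μ²A·Tₙ⁻²)` — `H″(T) = H²·V`, `V = μ²A·Tₙ⁻²`, `V(0) = A(0)`. [cite: BlakestadGrant2023, Prop. 13] -/
theorem dworkShape_of_sq_functionalEquation_unit (h2 : (2 : K) ≠ 0) (μ : Kˣ) {σ σ'' T A Tn : K⟦X⟧}
    (hσ0 : constantCoeff σ = 0) (hσ0'' : constantCoeff σ'' = 0) (hT0 : constantCoeff T = 0)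
    (hTn : sigmaShift T = C (2 : K) * Tn) (hTn0 : constantCoeff Tn = μ)
    (hFE : X ^ 2 * σ''.subst T ^ 2 = C (2 * (μ : K)) ^ 2 * σ ^ 4 * A) :
    (sigmaShift σ'' ^ 2).subst T = (sigmaShift σ ^ 2) ^ 2 * (C ((μ : K) ^ 2) * A * invOfUnit (Tn ^ 2) (μ ^ 2)) := by
  have hs : HasSubst T := HasSubst.of_constantCoeff_zero' hT0
  have hinv : Tn ^ 2 * invOfUnit (Tn ^ 2) (μ ^ 2) = 1 :=
    mul_invOfUnit (Tn ^ 2) (μ ^ 2) (by rw [map_pow, hTn0, Units.val_pow_eq_pow_val])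
  have hT : T = C (2 : K) * X * Tn := by
    rw [← X_mul_sigmaShift hT0, hTn]; ring
  have hσ : σ = X * sigmaShift σ := (X_mul_sigmaShift hσ0).symm
  have hσT := subst_eq_mul_sigmaShift_subst hσ0'' hT0
  set sT := (sigmaShift σ'').subst T with hsT
  set s := sigmaShift σ with hsdef
  have hFE' : (C (4 : K) * X ^ 4) * (Tn ^ 2 * sT ^ 2) = (C (4 : K) * X ^ 4) * (C ((μ : K) ^ 2) * s ^ 4 * A) := by
    have e := hFE
    rw [hσT, hT, hσ] at e
    have h4 : (C (4 : K) : K⟦X⟧) = C 2 * C 2 := by rw [← map_mul]; norm_num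
    have hμ2 : (C (2 * (μ : K)) : K⟦X⟧) = C 2 * C (μ : K) := by rw [← map_mul]
    have hμsq : (C ((μ : K) ^ 2) : K⟦X⟧) = C (μ : K) ^ 2 := by rw [map_pow]
    rw [h4, hμsq]
    rw [hμ2] at e
    linear_combination e
  have hne : (C (4 : K) : K⟦X⟧) * X ^ 4 ≠ 0 := by
    refine mul_ne_zero ?_ (pow_ne_zero 4 X_ne_zero)
    have h4 : (4 : K) ≠ 0 := by
      have : (4 : K) = 2 * 2 := by norm_num
      rw [this]; exact mul_ne_zero h2 h2
    intro h
    apply h4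
    have := congrArg constantCoeff h
    rwa [constantCoeff_C, map_zero] at this
  have hkey : Tn ^ 2 * sT ^ 2 = C ((μ : K) ^ 2) * s ^ 4 * A := mul_left_cancel₀ hne hFE'
  rw [subst_pow hs]
  calc sT ^ 2 = sT ^ 2 * (Tn ^ 2 * invOfUnit (Tn ^ 2) (μ ^ 2)) := by rw [hinv, mul_one]
    _ = (Tn ^ 2 * sT ^ 2) * invOfUnit (Tn ^ 2) (μ ^ 2) := by ring
    _ = (s ^ 2) ^ 2 * (C ((μ : K) ^ 2) * A * invOfUnit (Tn ^ 2) (μ ^ 2)) := by rw [hkey]; ring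

end Shape

end Summit.BirchSwinnertonDyer.BirchSwinnertonDyer.Theorems.AlignedTransportAtTwoSigmaSqTwo
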